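import Summits.CriticalPhenomena.PercolationContinuityZ3.Theorems.PercNearOneGluingNoHeavyLowerTailKnQuestion8CoefficientwiseRemSPPieces
import Summits.CriticalPhenomena.PercolationContinuityZ3.Theorems.PercNearOneGluingNoHeavyLowerTailKnQuestion8CoefficientwiseTrivialCoreFlip
import HarnessLib

/-!
# THEOREM U3-CLOSURE, parallel step: the component map of one piece (rows `R1`/`R0`/`N` or complement) — prim-lf-2 gen 69

Support file (`--supports stmt-CriticalPhenomena-4575`, closed), prover `prim-lf-2` (gen 69).  No definitions, no named facts, no sorries; standard axioms.
Memo `prim-lf-2/CW-SP-gen69.md` §4.2 (PARALLEL).  For ONE piece `(E; x, h)` with rows for `pieceR0`, `pieceR1`, `pieceN` (…RemSPPieces) we build the map used on a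
component of a parallel composition: on a colouring `s` that is 'OK' (`h ∉ C_x(E∖s)`, no target in `(C_x s ∪ C_h s) ∩ C_x(E∖s)`) it applies the `R1`-row,
the `R0`-row, the `N`-row or the complement `E ∖ s` according to the class of `s`; it preserves OK, the red-through bit `h ∈ C_x s`, the flag 'some target
`≠ h` in `(C_x s ∪ C_h s) ∩ C_h(E∖s)`', dominates (`C_x(E∖s) ⊆ C_x(f s)`) and is injective on OK colourings.
* `Coefficientwise.exists_parallel_componentMap`.
[cite: KozmaNitzan2024, Questions 8–9 (§5.5 p. 36) (context: the Question-8 pocket covariance programme)]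
-/

namespace Summit.CriticalPhenomena.PercolationContinuityZ3.Theorems

open Finset Literature.Probability.Percolation

namespace Coefficientwise

variable {ι V : Type*} [DecidableEq ι] (ends : ι → Sym2 V)

open Classical in
/-- **The component map for parallel composition.**  See the module docstring. [cite: KozmaNitzan2024, Questions 8–9 (§5.5 p. 36) (context)] -/
theorem exists_parallel_componentMap (E : Finset ι) (x h : V) (W : Set V)
    (hA : HasDomRow ends E x (pieceR0 ends E x h W)) (hB : HasDomRow ends E x (pieceR1 ends E x h W)) (hC : HasDomRow ends E x (pieceN ends E x h W)) :
    ∃ f : Finset ι → Finset ι,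
      (∀ s, s ⊆ E →
        (h ∉ openCluster (ends '' (↑(E \ s) : Set ι)) x ∧ ∀ w ∈ W, ¬ ((w ∈ openCluster (ends '' (↑s : Set ι)) x ∨ w ∈ openCluster (ends '' (↑s : Set ι)) h) ∧
            w ∈ openCluster (ends '' (↑(E \ s) : Set ι)) x)) →
        (f s ⊆ E ∧
         (h ∉ openCluster (ends '' (↑(E \ f s) : Set ι)) x ∧ ∀ w ∈ W, ¬ ((w ∈ openCluster (ends '' (↑(f s) : Set ι)) x ∨ w ∈ openCluster (ends '' (↑(f s) : Set ι)) h) ∧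
            w ∈ openCluster (ends '' (↑(E \ f s) : Set ι)) x)) ∧
         (h ∈ openCluster (ends '' (↑(f s) : Set ι)) x ↔ h ∈ openCluster (ends '' (↑s : Set ι)) x) ∧
         ((∃ w ∈ W, w ≠ h ∧ (w ∈ openCluster (ends '' (↑(f s) : Set ι)) x ∨ w ∈ openCluster (ends '' (↑(f s) : Set ι)) h) ∧
              w ∈ openCluster (ends '' (↑(E \ f s) : Set ι)) h) ↔
           (∃ w ∈ W, w ≠ h ∧ (w ∈ openCluster (ends '' (↑s : Set ι)) x ∨ w ∈ openCluster (ends '' (↑s : Set ι)) h) ∧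
              w ∈ openCluster (ends '' (↑(E \ s) : Set ι)) h)) ∧
         openCluster (ends '' (↑(E \ s) : Set ι)) x ⊆ openCluster (ends '' (↑(f s) : Set ι)) x)) ∧
      (∀ s s', s ⊆ E →
        (h ∉ openCluster (ends '' (↑(E \ s) : Set ι)) x ∧ ∀ w ∈ W, ¬ ((w ∈ openCluster (ends '' (↑s : Set ι)) x ∨ w ∈ openCluster (ends '' (↑s : Set ι)) h) ∧
            w ∈ openCluster (ends '' (↑(E \ s) : Set ι)) x)) →
        s' ⊆ E →
        (h ∉ openCluster (ends '' (↑(E \ s') : Set ι)) x ∧ ∀ w ∈ W, ¬ ((w ∈ openCluster (ends '' (↑s' : Set ι)) x ∨ w ∈ openCluster (ends '' (↑s' : Set ι)) h) ∧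
            w ∈ openCluster (ends '' (↑(E \ s') : Set ι)) x)) →
        f s = f s' → s = s') := by
  obtain ⟨πA, hmA, hiA, hdA⟩ := hA
  obtain ⟨πB, hmB, hiB, hdB⟩ := hB
  obtain ⟨πC, hmC, hiC, hdC⟩ := hC
  set Cx : Finset ι → Set V := fun s => openCluster (ends '' (↑s : Set ι)) x with hCx
  set Ch : Finset ι → Set V := fun s => openCluster (ends '' (↑s : Set ι)) h with hCh
  set OK : Finset ι → Finset ι → Prop := fun E s => h ∉ Cx (E \ s) ∧ ∀ w ∈ W, ¬ ((w ∈ Cx s ∨ w ∈ Ch s) ∧ w ∈ Cx (E \ s)) with hOK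
  set RED : Finset ι → Prop := fun s => h ∈ Cx s with hRED
  set FL : Finset ι → Finset ι → Prop := fun E s => ∃ w ∈ W, w ≠ h ∧ (w ∈ Cx s ∨ w ∈ Ch s) ∧ w ∈ Ch (E \ s) with hFL
  set XH : Finset ι → Finset ι → Prop := fun E s => ∃ w ∈ W, w ∈ Cx s ∧ w ∈ Ch (E \ s) with hXH
  -- membership transfer inside a red-through piece: C_h s = C_x s when h ∈ C_x s
  have red_eq : ∀ s : Finset ι, h ∈ Cx s → ∀ y, (y ∈ Ch s ↔ y ∈ Cx s) := by
    intro s hh y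
    constructor
    · intro hy; exact SimpleGraph.Reachable.trans hh hy
    · intro hy; exact SimpleGraph.Reachable.trans ((mem_openCluster_comm ends s x h).mp hh) hy
  -- x is on both sides of its own clusters: a component predicate OK forces x ∉ W
  -- 2. the component classes in terms of OK / RED / FL / XH
  have R0_iff : ∀ E s, pieceR0 ends E x h W s ↔ (OK E s ∧ RED s ∧ ¬ FL E s) := by
    intro E s
    unfold pieceR0
    constructor
    · rintro ⟨hr, hb, hnx, hnf⟩
      refine ⟨⟨hb, fun w hw hh => hnx w hw ⟨?_, hh.2⟩⟩, hr, ?_⟩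
      · rcases hh.1 with h1 | h1
        · exact h1
        · exact (red_eq s hr w).mp h1
      · rintro ⟨w, hw, hwh, hwK, hwP⟩
        refine hnf w hw hwh ⟨?_, hwP⟩
        rcases hwK with h1 | h1
        · exact h1
        · exact (red_eq s hr w).mp h1
    · rintro ⟨⟨hb, hnx⟩, hr, hnf⟩
      exact ⟨hr, hb, fun w hw hh => hnx w hw ⟨Or.inl hh.1, hh.2⟩, fun w hw hwh hh => hnf ⟨w, hw, hwh, Or.inl hh.1, hh.2⟩⟩
  have R1_iff : ∀ E s, pieceR1 ends E x h W s ↔ (OK E s ∧ RED s ∧ FL E s) := by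
    intro E s
    unfold pieceR1
    constructor
    · rintro ⟨hr, hb, hnx, ⟨w, hw, hwh, hwK, hwP⟩⟩
      refine ⟨⟨hb, fun w hw hh => hnx w hw ⟨?_, hh.2⟩⟩, hr, ⟨w, hw, hwh, Or.inl hwK, hwP⟩⟩
      rcases hh.1 with h1 | h1
      · exact h1
      · exact (red_eq s hr w).mp h1
    · rintro ⟨⟨hb, hnx⟩, hr, ⟨w, hw, hwh, hwK, hwP⟩⟩
      refine ⟨hr, hb, fun w hw hh => hnx w hw ⟨Or.inl hh.1, hh.2⟩, ⟨w, hw, hwh, ?_, hwP⟩⟩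
      rcases hwK with h1 | h1
      · exact h1
      · exact (red_eq s hr w).mp h1
  have N_iff : ∀ E s, pieceN ends E x h W s ↔ (OK E s ∧ ¬ RED s ∧ XH E s) := by
    intro E s
    unfold pieceN
    constructor
    · rintro ⟨hr, hb, hnx, hnhx, hX⟩
      refine ⟨⟨hb, fun w hw hh => ?_⟩, hr, hX⟩
      rcases hh.1 with h1 | h1
      · exact hnx w hw ⟨h1, hh.2⟩
      · exact hnhx w hw ⟨h1, hh.2⟩
    · rintro ⟨⟨hb, hnx⟩, hr, hX⟩
      exact ⟨hr, hb, fun w hw hh => hnx w hw ⟨Or.inl hh.1, hh.2⟩, fun w hw hh => hnx w hw ⟨Or.inr hh.1, hh.2⟩, hX⟩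
  -- N-colourings are flagged
  have FL_of_N : ∀ E s, pieceN ends E x h W s → FL E s := by
    intro E s hN
    obtain ⟨hr, -, -, -, ⟨w, hw, hwK, hwP⟩⟩ := hN
    exact ⟨w, hw, fun hwh => hr (hwh ▸ hwK), Or.inl hwK, hwP⟩
  -- the complement on OK ∧ ¬RED ∧ ¬XH colourings
  have compl_props : ∀ (E s : Finset ι), s ⊆ E → OK E s → ¬ RED s → ¬ XH E s →
      (OK E (E \ s) ∧ ¬ RED (E \ s) ∧ ¬ XH E (E \ s) ∧ (FL E (E \ s) ↔ FL E s)) := by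
    intro E s hs hO hr hX
    obtain ⟨hb, hnx⟩ := hO
    have hss : E \ (E \ s) = s := Finset.sdiff_sdiff_eq_self hs
    refine ⟨⟨?_, ?_⟩, hb, ?_, ?_⟩
    · rw [hss]; exact hr
    · intro w hw hh
      rw [hss] at hh
      obtain ⟨hw1, hw2⟩ := hh
      rcases hw1 with h1 | h1
      · exact hnx w hw ⟨Or.inl hw2, h1⟩
      · exact hX ⟨w, hw, hw2, h1⟩
    · rintro ⟨w, hw, hwB, hwK⟩
      rw [hss] at hwK
      exact hnx w hw ⟨Or.inr hwK, hwB⟩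
    · rw [hFL]; simp only [hss]
      constructor
      · rintro ⟨w, hw, hwh, hw1, hw2⟩
        rcases hw1 with h1 | h1
        · exact absurd ⟨Or.inr hw2, h1⟩ (hnx w hw)
        · exact ⟨w, hw, hwh, Or.inr hw2, h1⟩
      · rintro ⟨w, hw, hwh, hw1, hw2⟩
        rcases hw1 with h1 | h1
        · exact absurd ⟨w, hw, h1, hw2⟩ hX
        · exact ⟨w, hw, hwh, Or.inr hw2, h1⟩
  set f : Finset ι → Finset ι := fun s => if pieceR1 ends E x h W s then πB s else if pieceR0 ends E x h W s then πA s
      else if pieceN ends E x h W s then πC s else E \ s with hf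
  have f_props : ∀ (E : Finset ι) (πA πB πC f : Finset ι → Finset ι),
      (∀ s, s ⊆ E → pieceR0 ends E x h W s → (πA s ⊆ E ∧ pieceR0 ends E x h W (πA s))) →
      (∀ s, s ⊆ E → pieceR0 ends E x h W s → Cx (E \ s) ⊆ Cx (πA s)) →
      (∀ s, s ⊆ E → pieceR1 ends E x h W s → (πB s ⊆ E ∧ pieceR1 ends E x h W (πB s))) →
      (∀ s, s ⊆ E → pieceR1 ends E x h W s → Cx (E \ s) ⊆ Cx (πB s)) →
      (∀ s, s ⊆ E → pieceN ends E x h W s → (πC s ⊆ E ∧ pieceN ends E x h W (πC s))) →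
      (∀ s, s ⊆ E → pieceN ends E x h W s → Cx (E \ s) ⊆ Cx (πC s)) →
      (f = fun s => if pieceR1 ends E x h W s then πB s else if pieceR0 ends E x h W s then πA s
        else if pieceN ends E x h W s then πC s else E \ s) →
      ∀ s, s ⊆ E → OK E s →
        (f s ⊆ E ∧ OK E (f s) ∧ (RED (f s) ↔ RED s) ∧ (FL E (f s) ↔ FL E s) ∧ Cx (E \ s) ⊆ Cx (f s)) := by
    intro E πA πB πC f hmA hdA hmB hdB hmC hdC hf s hs hO
    by_cases h1 : pieceR1 ends E x h W s
    · have hfs : f s = πB s := by rw [hf]; exact if_pos h1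
      rw [hfs]
      obtain ⟨hsub, hP⟩ := hmB s hs h1
      obtain ⟨hO', hr', hF'⟩ := (R1_iff E _).mp hP
      obtain ⟨-, hr, hF⟩ := (R1_iff E _).mp h1
      exact ⟨hsub, hO', ⟨fun _ => hr, fun _ => hr'⟩, ⟨fun _ => hF, fun _ => hF'⟩, hdB s hs h1⟩
    by_cases h0 : pieceR0 ends E x h W s
    · have hfs : f s = πA s := by rw [hf]; simp only [if_neg h1, if_pos h0]
      rw [hfs]
      obtain ⟨hsub, hP⟩ := hmA s hs h0
      obtain ⟨hO', hr', hF'⟩ := (R0_iff E _).mp hP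
      obtain ⟨-, hr, hF⟩ := (R0_iff E _).mp h0
      exact ⟨hsub, hO', ⟨fun _ => hr, fun _ => hr'⟩, ⟨fun h => absurd h hF', fun h => absurd h hF⟩, hdA s hs h0⟩
    -- not red: else s would be in R0 or R1
    have hnr : ¬ RED s := by
      intro hr
      by_cases hF : FL E s
      · exact h1 ((R1_iff E s).mpr ⟨hO, hr, hF⟩)
      · exact h0 ((R0_iff E s).mpr ⟨hO, hr, hF⟩)
    by_cases hN : pieceN ends E x h W s
    · have hfs : f s = πC s := by rw [hf]; simp only [if_neg h1, if_neg h0, if_pos hN]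
      rw [hfs]
      obtain ⟨hsub, hP⟩ := hmC s hs hN
      obtain ⟨hO', hr', -⟩ := (N_iff E _).mp hP
      exact ⟨hsub, hO', ⟨fun h => absurd h hr', fun h => absurd h hnr⟩, ⟨fun _ => FL_of_N E s hN, fun _ => FL_of_N E _ hP⟩, hdC s hs hN⟩
    · have hfs : f s = E \ s := by rw [hf]; simp only [if_neg h1, if_neg h0, if_neg hN]
      rw [hfs]
      have hX : ¬ XH E s := fun hX => hN ((N_iff E s).mpr ⟨hO, hnr, hX⟩)
      obtain ⟨hO', hr', -, hF'⟩ := compl_props E s hs hO hnr hX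
      exact ⟨Finset.sdiff_subset, hO', ⟨fun h => absurd h hr', fun h => absurd h hnr⟩, hF', le_rfl⟩
  have f_inj : ∀ (E : Finset ι) (πA πB πC f : Finset ι → Finset ι),
      (∀ s, s ⊆ E → pieceR0 ends E x h W s → (πA s ⊆ E ∧ pieceR0 ends E x h W (πA s))) →
      (∀ s₁ s₂, s₁ ⊆ E → pieceR0 ends E x h W s₁ → s₂ ⊆ E → pieceR0 ends E x h W s₂ → πA s₁ = πA s₂ → s₁ = s₂) →
      (∀ s, s ⊆ E → pieceR1 ends E x h W s → (πB s ⊆ E ∧ pieceR1 ends E x h W (πB s))) →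
      (∀ s₁ s₂, s₁ ⊆ E → pieceR1 ends E x h W s₁ → s₂ ⊆ E → pieceR1 ends E x h W s₂ → πB s₁ = πB s₂ → s₁ = s₂) →
      (∀ s, s ⊆ E → pieceN ends E x h W s → (πC s ⊆ E ∧ pieceN ends E x h W (πC s))) →
      (∀ s₁ s₂, s₁ ⊆ E → pieceN ends E x h W s₁ → s₂ ⊆ E → pieceN ends E x h W s₂ → πC s₁ = πC s₂ → s₁ = s₂) →
      (f = fun s => if pieceR1 ends E x h W s then πB s else if pieceR0 ends E x h W s then πA s
        else if pieceN ends E x h W s then πC s else E \ s) →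
      ∀ s s', s ⊆ E → OK E s → s' ⊆ E → OK E s' → f s = f s' → s = s' := by
    intro E πA πB πC f hmA hiA hmB hiB hmC hiC hf
    -- the sub-class of `f s` determines the sub-class of `s`
    have cls : ∀ s, s ⊆ E → OK E s →
        (pieceR1 ends E x h W s ∧ f s = πB s ∧ pieceR1 ends E x h W (f s)) ∨
        (pieceR0 ends E x h W s ∧ f s = πA s ∧ pieceR0 ends E x h W (f s)) ∨
        (pieceN ends E x h W s ∧ f s = πC s ∧ pieceN ends E x h W (f s)) ∨
        (¬ pieceR1 ends E x h W s ∧ ¬ pieceR0 ends E x h W s ∧ ¬ pieceN ends E x h W s ∧ f s = E \ s ∧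
          ¬ pieceR1 ends E x h W (f s) ∧ ¬ pieceR0 ends E x h W (f s) ∧ ¬ pieceN ends E x h W (f s)) := by
      intro s hs hO
      by_cases h1 : pieceR1 ends E x h W s
      · have hfs : f s = πB s := by rw [hf]; exact if_pos h1
        exact Or.inl ⟨h1, hfs, hfs ▸ (hmB s hs h1).2⟩
      by_cases h0 : pieceR0 ends E x h W s
      · have hfs : f s = πA s := by rw [hf]; simp only [if_neg h1, if_pos h0]
        exact Or.inr (Or.inl ⟨h0, hfs, hfs ▸ (hmA s hs h0).2⟩)
      by_cases hN : pieceN ends E x h W s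
      · have hfs : f s = πC s := by rw [hf]; simp only [if_neg h1, if_neg h0, if_pos hN]
        exact Or.inr (Or.inr (Or.inl ⟨hN, hfs, hfs ▸ (hmC s hs hN).2⟩))
      · have hfs : f s = E \ s := by rw [hf]; simp only [if_neg h1, if_neg h0, if_neg hN]
        have hnr : ¬ RED s := by
          intro hr
          by_cases hF : FL E s
          · exact h1 ((R1_iff E s).mpr ⟨hO, hr, hF⟩)
          · exact h0 ((R0_iff E s).mpr ⟨hO, hr, hF⟩)
        have hX : ¬ XH E s := fun hX => hN ((N_iff E s).mpr ⟨hO, hnr, hX⟩)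
        obtain ⟨hO', hr', hX', -⟩ := compl_props E s hs hO hnr hX
        refine Or.inr (Or.inr (Or.inr ⟨h1, h0, hN, hfs, ?_, ?_, ?_⟩))
        · rw [hfs]; exact fun hP => hr' ((R1_iff E _).mp hP).2.1
        · rw [hfs]; exact fun hP => hr' ((R0_iff E _).mp hP).2.1
        · rw [hfs]; exact fun hP => hX' ((N_iff E _).mp hP).2.2
    -- disjointness of the classes
    have dR1R0 : ∀ s, pieceR1 ends E x h W s → ¬ pieceR0 ends E x h W s :=
      fun s hB hA => ((R0_iff E s).mp hA).2.2 ((R1_iff E s).mp hB).2.2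
    have dRN : ∀ s, RED s → ¬ pieceN ends E x h W s := fun s hr hN => ((N_iff E s).mp hN).2.1 hr
    intro s s' hs hO hs' hO' heq
    rcases cls s hs hO with ⟨c1, e1, i1⟩ | ⟨c1, e1, i1⟩ | ⟨c1, e1, i1⟩ | ⟨n1, n0, nN, e1, i1, i0, iN⟩ <;>
      rcases cls s' hs' hO' with ⟨c1', e1', i1'⟩ | ⟨c1', e1', i1'⟩ | ⟨c1', e1', i1'⟩ | ⟨n1', n0', nN', e1', i1', i0', iN'⟩
    -- 16 cases: equal classes use injectivity, different classes contradict via the image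
    · exact hiB s s' hs c1 hs' c1' (by rw [← e1, ← e1', heq])
    · exact (dR1R0 _ (heq ▸ i1) i1').elim
    · exact ((dRN _ ((R1_iff E _).mp (heq ▸ i1)).2.1) i1').elim
    · exact (i1' (heq ▸ i1)).elim
    · exact (dR1R0 _ (heq.symm ▸ i1') i1).elim
    · exact hiA s s' hs c1 hs' c1' (by rw [← e1, ← e1', heq])
    · exact ((dRN _ ((R0_iff E _).mp (heq ▸ i1)).2.1) i1').elim
    · exact (i0' (heq ▸ i1)).elim
    · exact ((dRN _ ((R1_iff E _).mp (heq.symm ▸ i1')).2.1) i1).elim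
    · exact ((dRN _ ((R0_iff E _).mp (heq.symm ▸ i1')).2.1) i1).elim
    · exact hiC s s' hs c1 hs' c1' (by rw [← e1, ← e1', heq])
    · exact (iN' (heq ▸ i1)).elim
    · exact (i1 (heq.symm ▸ i1')).elim
    · exact (i0 (heq.symm ▸ i1')).elim
    · exact (iN (heq.symm ▸ i1')).elim
    · have : E \ s = E \ s' := by rw [← e1, ← e1', heq]
      rw [← Finset.sdiff_sdiff_eq_self hs, this, Finset.sdiff_sdiff_eq_self hs']
  refine ⟨f, fun s hs hO => f_props E πA πB πC f hmA hdA hmB hdB hmC hdC hf s hs hO,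
    fun s s' hs hO hs' hO' heq => f_inj E πA πB πC f hmA hiA hmB hiB hmC hiC hf s s' hs hO hs' hO' heq⟩

end Coefficientwise

end Summit.CriticalPhenomena.PercolationContinuityZ3.Theorems
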